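import Summits.QuantumFields.YangMills.Theorems.FluctuationComparisonRegPrIntLOddsLedgerReduction
import Summits.QuantumFields.YangMills.Theorems.FluctuationComparisonRegPrIntLOddsLedgerPregEnds
import Summits.QuantumFields.YangMills.Theorems.FluctuationComparisonRegPrIntLOddsLedgerTopIncrement
import HarnessLib

/-!
# `FluctuationComparisonRegPrIntLOddsLedgerReductionOfInteriorRegSet` — LINE g20-2 «ODDS LEDGER»: LFR♯ᶜ ⟸ PWREG-int ∧ LEV, BY NAME
# (crux `UnitScaleTilt.FluctuationComparisonRegPrIntL`, stmt-QuantumFields-20520; organ LFR♯ᶜ `LargeFieldFourPtCan`; line file `Cruxes/…/Lines/odds_ledger.lean` v1.2)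

Cell `ym3-torus` (YM ladder rung R3 = continuum SU(2) Yang–Mills on T³ — a RUNG, NOT the Clay problem: not d = 4, not infinite volume, not a mass gap);
width seat `ym3-torus-px19` (gen 11); helper `--supports stmt-QuantumFields-20520`.  TWO THEOREMS (0 `def`, 0 `sorry`, default heartbeats; v1.1 adds §2).

WHAT.  The knit of two landed files: ✓`…OddsLedgerReduction.largeFieldFourPtCan_of_partialWindowPositivity'_of_levelOddsLedger` (LFR♯ᶜ ⟸ PREG′ ∧ LEV, VERS ✓p752318
inside; this seat) and px16 g12's ✓`…OddsLedgerPregEnds.partialWindowPositivity_of_interiorRegSet` (PREG′ ⟸ PWREG-int: the two ENDS of the depth filtration — `M = 0` by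
✓`…PregLow`, `M ≥ K − J` by px21 g12's ✓`…PregTop` — are theorems, only the INTERIOR depths `0 < M < K − J` keep a regularity row).  Hence, importably and by name:
★★★`largeFieldFourPtCan_of_interiorRegSet_of_levelOddsLedger : PWREG-int → LEV → LFR♯ᶜ` — the organ LFR♯ᶜ of S2β reduced to PWREG-int (window regularity of the
partially constrained densities at interior depths) and LEV (the per-scale pinned ledger budget, XL); on the first rung `K = J + 1` the interior is EMPTY, so LEV₁ alone
feeds the depth-one LFR♯ᶜ (★★OWNER WORD 62).
HONEST SCOPE.  A one-line knit; PWREG-int, LEV, LFR♯ᶜ, S2β, `FluctuationComparisonRegPrIntL` 20520 and `YM3TorusSU2` are NOT proved; no summit statement is proved; the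
Yang–Mills mass gap is NOT proved.
References: [Balaban1985UV3] (7) p. 257, (38)–(47) pp. 266–267.
-/

noncomputable section

set_option autoImplicit false

open MeasureTheory Filter Topology Set
open scoped BigOperators
open Literature.MathematicalPhysics.QuantumFieldTheory.Balaban1983to89
open Literature.MathematicalPhysics.QuantumFieldTheory.Balaban1983to89.T3ContinuumYM3Torus
open Literature.MathematicalPhysics.QuantumFieldTheory.Balaban1983to89.T3NestedUnitLaws
open Literature.MathematicalPhysics.QuantumFieldTheory.Balaban1983to89.T3UnitLawDensityEML
open Literature.MathematicalPhysics.QuantumFieldTheory.Balaban1983to89.T3UnitScaleTilt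
open Literature.MathematicalPhysics.QuantumFieldTheory.Balaban1983to89.T3TiltDescent
open Summit.QuantumFields.YangMills.Theorems.FluctuationComparisonRegPrIntLWregGlue (heightDensityCan)
open Summit.QuantumFields.YangMills.Theorems.FluctuationComparisonRegPrIntLOddsLedgerReduction
  (largeFieldFourPtCan_of_partialWindowPositivity'_of_levelOddsLedger)
open Summit.QuantumFields.YangMills.Theorems.FluctuationComparisonRegPrIntLOddsLedgerPregEnds (partialWindowPositivity_of_interiorRegSet)
open Summit.QuantumFields.YangMills.Theorems.FluctuationComparisonRegPrIntLOddsLedgerTopIncrement (levelOddsLedger_of_below)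

namespace Summit.QuantumFields.YangMills.Theorems.FluctuationComparisonRegPrIntLOddsLedgerReductionOfInteriorRegSet

/-- ★★★ **LFR♯ᶜ ⟸ PWREG-int ∧ LEV** (the odds-ledger line's organ surface after VERS ✓, PREG-LOW ✓, PREG-TOP ✓): from the interior-depth window-regularity row
PWREG-int (px16 g12's `hint`, VERBATIM) and the per-scale ledger budget LEV (VERBATIM, unfolded), the large-field 4-point remainder LFR♯ᶜ `LargeFieldFourPtCan`
(VERBATIM, `fourPt` unfolded). [cite: Balaban1985UV3, (38)-(47) p.266-267] -/
theorem largeFieldFourPtCan_of_interiorRegSet_of_levelOddsLedger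
    (hint : ∀ (L : ℕ), ∃ pS : ℝ, ∀ (b₀ p₀ : ℝ), 0 < b₀ → pS ≤ p₀ → 0 < p₀ →
      ∃ γ₁ : ℝ, 0 < γ₁ ∧ ∀ (F : T3Family) (γ : ℝ), F.L = L → 0 < γ → γ ≤ γ₁ →
        ∀ (J K : ℕ) (hJK : J ≤ K) (M : ℕ), 0 < M → M < K - J →
          {V : GaugeField (F.P J) 0 (Matrix.specialUnitaryGroup (Fin 2) ℂ) | PlaqSmall (θBal F.L γ b₀ p₀ J) V} ⊆
            Node00.regSet (fieldMeasure (F.P J) 0 (Matrix.specialUnitaryGroup (Fin 2) ℂ))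
              (heightDensity F γ hJK
                {U' : GaugeField (F.P K) 0 (Matrix.specialUnitaryGroup (Fin 2) ℂ) | ∀ j, j + J ≤ K → j < M →
                  PlaqSmall (θBal F.L γ b₀ p₀ (K - j)) (Averaging.iter (fun i => BlockAveraging.blockAvg (P := F.P K) (j := i) ℰp) j U')}))
    (hL :
    ∀ (L : ℕ), ∃ pS : ℝ, ∀ (b₀ p₀ : ℝ), 0 < b₀ → pS ≤ p₀ → 0 < p₀ →
      ∃ γ₁ : ℝ, 0 < γ₁ ∧ ∃ κ : ℝ, 0 < κ ∧ ∀ (F : T3Family) (γ : ℝ), F.L = L → 0 < γ → γ ≤ γ₁ →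
        ∃ w : ℕ → ℕ → ℝ, (∀ J r, 0 ≤ w J r) ∧
          ∃ ψ : ℕ → ℝ, (∀ J, 0 ≤ ψ J) ∧ Tendsto (fun J : ℕ => (J : ℝ) * ψ J) atTop (𝓝 0) ∧
            (∀ J R, ∑ r ∈ Finset.range R, w J r ≤ ψ J) ∧
            ∀ (J K : ℕ) (hJK : J ≤ K),
              (∀ (M : ℕ) (U : GaugeField (F.P J) 0 (Matrix.specialUnitaryGroup (Fin 2) ℂ)), PlaqSmall (θBal F.L γ b₀ p₀ J) U →
                  0 < heightDensityCan F γ hJK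
                {Y : GaugeField (F.P K) 0 (Matrix.specialUnitaryGroup (Fin 2) ℂ) | ∀ j, j + J ≤ K → j < M → PlaqSmall (θBal F.L γ b₀ p₀ (K - j))
                  (Averaging.iter (fun i => BlockAveraging.blockAvg (P := F.P K) (j := i) ℰp) j Y)} U) →
              ∀ (M : ℕ), M + J ≤ K →
              ∀ (b b' : PBond (F.P J) 0) (U V W Z : GaugeField (F.P J) 0 (Matrix.specialUnitaryGroup (Fin 2) ℂ)),
                PlaqSmall (θBal F.L γ b₀ p₀ J) U → PlaqSmall (θBal F.L γ b₀ p₀ J) V →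
                PlaqSmall (θBal F.L γ b₀ p₀ J) W → PlaqSmall (θBal F.L γ b₀ p₀ J) Z →
                (∀ e, e ≠ b → U e = V e) → (∀ e, e ≠ b' → U e = W e) → (∀ e, e ≠ b' → V e = Z e) → (∀ e, e ≠ b → W e = Z e) →
                |(((Real.log (heightDensityCan F γ hJK
                {Y : GaugeField (F.P K) 0 (Matrix.specialUnitaryGroup (Fin 2) ℂ) | ∀ j, j + J ≤ K → j < M → PlaqSmall (θBal F.L γ b₀ p₀ (K - j))
                  (Averaging.iter (fun i => BlockAveraging.blockAvg (P := F.P K) (j := i) ℰp) j Y)} U)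
              - Real.log (heightDensityCan F γ hJK
                {Y : GaugeField (F.P K) 0 (Matrix.specialUnitaryGroup (Fin 2) ℂ) | ∀ j, j + J ≤ K → j < (M + 1) → PlaqSmall (θBal F.L γ b₀ p₀ (K - j))
                  (Averaging.iter (fun i => BlockAveraging.blockAvg (P := F.P K) (j := i) ℰp) j Y)} U)) - (Real.log (heightDensityCan F γ hJK
                {Y : GaugeField (F.P K) 0 (Matrix.specialUnitaryGroup (Fin 2) ℂ) | ∀ j, j + J ≤ K → j < M → PlaqSmall (θBal F.L γ b₀ p₀ (K - j))
                  (Averaging.iter (fun i => BlockAveraging.blockAvg (P := F.P K) (j := i) ℰp) j Y)} V)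
              - Real.log (heightDensityCan F γ hJK
                {Y : GaugeField (F.P K) 0 (Matrix.specialUnitaryGroup (Fin 2) ℂ) | ∀ j, j + J ≤ K → j < (M + 1) → PlaqSmall (θBal F.L γ b₀ p₀ (K - j))
                  (Averaging.iter (fun i => BlockAveraging.blockAvg (P := F.P K) (j := i) ℰp) j Y)} V)))
            - ((Real.log (heightDensityCan F γ hJK
                {Y : GaugeField (F.P K) 0 (Matrix.specialUnitaryGroup (Fin 2) ℂ) | ∀ j, j + J ≤ K → j < M → PlaqSmall (θBal F.L γ b₀ p₀ (K - j))
                  (Averaging.iter (fun i => BlockAveraging.blockAvg (P := F.P K) (j := i) ℰp) j Y)} W)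
              - Real.log (heightDensityCan F γ hJK
                {Y : GaugeField (F.P K) 0 (Matrix.specialUnitaryGroup (Fin 2) ℂ) | ∀ j, j + J ≤ K → j < (M + 1) → PlaqSmall (θBal F.L γ b₀ p₀ (K - j))
                  (Averaging.iter (fun i => BlockAveraging.blockAvg (P := F.P K) (j := i) ℰp) j Y)} W)) - (Real.log (heightDensityCan F γ hJK
                {Y : GaugeField (F.P K) 0 (Matrix.specialUnitaryGroup (Fin 2) ℂ) | ∀ j, j + J ≤ K → j < M → PlaqSmall (θBal F.L γ b₀ p₀ (K - j))
                  (Averaging.iter (fun i => BlockAveraging.blockAvg (P := F.P K) (j := i) ℰp) j Y)} Z)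
              - Real.log (heightDensityCan F γ hJK
                {Y : GaugeField (F.P K) 0 (Matrix.specialUnitaryGroup (Fin 2) ℂ) | ∀ j, j + J ≤ K → j < (M + 1) → PlaqSmall (θBal F.L γ b₀ p₀ (K - j))
                  (Averaging.iter (fun i => BlockAveraging.blockAvg (P := F.P K) (j := i) ℰp) j Y)} Z))))| ≤ w J (K - J - M) * Real.exp (-(κ * (b.src.tdist b'.src : ℝ)))) :
    ∀ (L : ℕ), ∃ pS : ℝ, ∀ (b₀ p₀ : ℝ), 0 < b₀ → pS ≤ p₀ → 0 < p₀ →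
      ∃ γ₁ : ℝ, 0 < γ₁ ∧ ∃ κ : ℝ, 0 < κ ∧ ∀ (F : T3Family) (γ : ℝ), F.L = L → 0 < γ → γ ≤ γ₁ →
        ∃ ψ : ℕ → ℝ, (∀ J, 0 ≤ ψ J) ∧ Tendsto (fun J : ℕ => (J : ℝ) * ψ J) atTop (𝓝 0) ∧
          ∀ (ν : ℕ → (j : ℕ) → Measure (GaugeField (F.P j) 0 (Matrix.specialUnitaryGroup (Fin 2) ℂ))),
            (∀ K, ν K K = T4GenFunBounds.gibbsMeasure (F.P K) ((F.scheme ℰp γ).β K)) →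
            (∀ K j, j < K → ν K j = Measure.map (descend F ℰp j) (ν K (j + 1))) →
            ∀ (J K : ℕ) (hJK : J ≤ K) (ρ : GaugeField (F.P J) 0 (Matrix.specialUnitaryGroup (Fin 2) ℂ) → ℝ),
              (∀ U, PlaqSmall (θBal F.L γ b₀ p₀ J) U → 0 < ρ U) →
              ν K J = (fieldMeasure _ _ _).withDensity (fun U => ENNReal.ofReal (ρ U)) →
              ContinuousOn ρ {U | PlaqSmall (θBal F.L γ b₀ p₀ J) U} →
              (∀ U : GaugeField (F.P J) 0 (Matrix.specialUnitaryGroup (Fin 2) ℂ), PlaqSmall (θBal F.L γ b₀ p₀ J) U →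
                  0 < heightDensityCan F γ hJK (histGood F ℰp (θBal F.L γ b₀ p₀) K J) U) →
              ∀ (b b' : PBond (F.P J) 0) (U V W Z : GaugeField (F.P J) 0 (Matrix.specialUnitaryGroup (Fin 2) ℂ)),
                PlaqSmall (θBal F.L γ b₀ p₀ J) U → PlaqSmall (θBal F.L γ b₀ p₀ J) V →
                PlaqSmall (θBal F.L γ b₀ p₀ J) W → PlaqSmall (θBal F.L γ b₀ p₀ J) Z →
                (∀ e, e ≠ b → U e = V e) → (∀ e, e ≠ b' → U e = W e) → (∀ e, e ≠ b' → V e = Z e) → (∀ e, e ≠ b → W e = Z e) →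
                |(((Real.log (ρ U) - Real.log (heightDensityCan F γ hJK (histGood F ℰp (θBal F.L γ b₀ p₀) K J) U)) - (Real.log (ρ V) - Real.log (heightDensityCan F γ hJK (histGood F ℰp (θBal F.L γ b₀ p₀) K J) V)))
            - ((Real.log (ρ W) - Real.log (heightDensityCan F γ hJK (histGood F ℰp (θBal F.L γ b₀ p₀) K J) W)) - (Real.log (ρ Z) - Real.log (heightDensityCan F γ hJK (histGood F ℰp (θBal F.L γ b₀ p₀) K J) Z))))|
                  ≤ ψ J * Real.exp (-(κ * (b.src.tdist b'.src : ℝ))) :=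
  largeFieldFourPtCan_of_partialWindowPositivity'_of_levelOddsLedger (partialWindowPositivity_of_interiorRegSet hint) hL


/-! ## §2 (v1.1 APPEND) … with px21 g12's LEV DOOR: LFR♯ᶜ ⟸ PWREG-int ∧ LEV-below -/

/-- ★★★ **LFR♯ᶜ ⟸ PWREG-int ∧ LEV-below** — the odds-ledger organ surface with BOTH landed doors applied: px16 g12's `…PregEnds.partialWindowPositivity_of_interiorRegSet`
(PREG′ ⟸ PWREG-int) and px21 g12's `…TopIncrement.levelOddsLedger_of_below` (LEV ⟸ LEV-below: the top increment vanishes on the window, so the budget row is only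
asked at depths `M + J < K`, i.e. with at least one cutoff-free transport above).  Hypotheses VERBATIM from the two doors; conclusion = LFR♯ᶜ `LargeFieldFourPtCan`
(`fourPt` unfolded).  On the first rung `K = J + 1`: PWREG-int is EMPTY and LEV-below is the single depth `M = 0`. [cite: Balaban1985UV3, (38)-(47) p.266-267] -/
theorem largeFieldFourPtCan_of_interiorRegSet_of_levelOddsLedgerBelow
    (hint : ∀ (L : ℕ), ∃ pS : ℝ, ∀ (b₀ p₀ : ℝ), 0 < b₀ → pS ≤ p₀ → 0 < p₀ →
      ∃ γ₁ : ℝ, 0 < γ₁ ∧ ∀ (F : T3Family) (γ : ℝ), F.L = L → 0 < γ → γ ≤ γ₁ →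
        ∀ (J K : ℕ) (hJK : J ≤ K) (M : ℕ), 0 < M → M < K - J →
          {V : GaugeField (F.P J) 0 (Matrix.specialUnitaryGroup (Fin 2) ℂ) | PlaqSmall (θBal F.L γ b₀ p₀ J) V} ⊆
            Node00.regSet (fieldMeasure (F.P J) 0 (Matrix.specialUnitaryGroup (Fin 2) ℂ))
              (heightDensity F γ hJK
                {U' : GaugeField (F.P K) 0 (Matrix.specialUnitaryGroup (Fin 2) ℂ) | ∀ j, j + J ≤ K → j < M →
                  PlaqSmall (θBal F.L γ b₀ p₀ (K - j)) (Averaging.iter (fun i => BlockAveraging.blockAvg (P := F.P K) (j := i) ℰp) j U')}))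
    (h : ∀ (L : ℕ), ∃ pS : ℝ, ∀ (b₀ p₀ : ℝ), 0 < b₀ → pS ≤ p₀ → 0 < p₀ →
      ∃ γ₁ : ℝ, 0 < γ₁ ∧ ∃ κ : ℝ, 0 < κ ∧ ∀ (F : T3Family) (γ : ℝ), F.L = L → 0 < γ → γ ≤ γ₁ →
        ∃ w : ℕ → ℕ → ℝ, (∀ J r, 0 ≤ w J r) ∧
          ∃ ψ : ℕ → ℝ, (∀ J, 0 ≤ ψ J) ∧ Tendsto (fun J : ℕ => (J : ℝ) * ψ J) atTop (𝓝 0) ∧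
            (∀ J R, ∑ r ∈ Finset.range R, w J r ≤ ψ J) ∧
            ∀ (J K : ℕ) (hJK : J ≤ K),
              (∀ (M : ℕ) (U : GaugeField (F.P J) 0 (Matrix.specialUnitaryGroup (Fin 2) ℂ)), PlaqSmall (θBal F.L γ b₀ p₀ J) U →
                  0 < heightDensityCan F γ hJK
                    {U' : GaugeField (F.P K) 0 (Matrix.specialUnitaryGroup (Fin 2) ℂ) | ∀ j, j + J ≤ K → j < M →
                      PlaqSmall (θBal F.L γ b₀ p₀ (K - j)) (Averaging.iter (fun i => BlockAveraging.blockAvg (P := F.P K) (j := i) ℰp) j U')} U) →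
              ∀ (M : ℕ), M + J < K →
                ∀ (b b' : PBond (F.P J) 0) (U V W Z : GaugeField (F.P J) 0 (Matrix.specialUnitaryGroup (Fin 2) ℂ)),
                  PlaqSmall (θBal F.L γ b₀ p₀ J) U → PlaqSmall (θBal F.L γ b₀ p₀ J) V →
                  PlaqSmall (θBal F.L γ b₀ p₀ J) W → PlaqSmall (θBal F.L γ b₀ p₀ J) Z →
                  (∀ e, e ≠ b → U e = V e) → (∀ e, e ≠ b' → U e = W e) → (∀ e, e ≠ b' → V e = Z e) → (∀ e, e ≠ b → W e = Z e) →
                  letI ℓ : GaugeField (F.P J) 0 (Matrix.specialUnitaryGroup (Fin 2) ℂ) → ℝ := fun X =>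
                    Real.log (heightDensityCan F γ hJK
                      {U' : GaugeField (F.P K) 0 (Matrix.specialUnitaryGroup (Fin 2) ℂ) | ∀ j, j + J ≤ K → j < M →
                        PlaqSmall (θBal F.L γ b₀ p₀ (K - j)) (Averaging.iter (fun i => BlockAveraging.blockAvg (P := F.P K) (j := i) ℰp) j U')} X) -
                    Real.log (heightDensityCan F γ hJK
                      {U' : GaugeField (F.P K) 0 (Matrix.specialUnitaryGroup (Fin 2) ℂ) | ∀ j, j + J ≤ K → j < M + 1 →
                        PlaqSmall (θBal F.L γ b₀ p₀ (K - j)) (Averaging.iter (fun i => BlockAveraging.blockAvg (P := F.P K) (j := i) ℰp) j U')} X)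
                  |(ℓ U - ℓ V) - (ℓ W - ℓ Z)| ≤ w J (K - J - M) * Real.exp (-(κ * (b.src.tdist b'.src : ℝ)))) :
    ∀ (L : ℕ), ∃ pS : ℝ, ∀ (b₀ p₀ : ℝ), 0 < b₀ → pS ≤ p₀ → 0 < p₀ →
      ∃ γ₁ : ℝ, 0 < γ₁ ∧ ∃ κ : ℝ, 0 < κ ∧ ∀ (F : T3Family) (γ : ℝ), F.L = L → 0 < γ → γ ≤ γ₁ →
        ∃ ψ : ℕ → ℝ, (∀ J, 0 ≤ ψ J) ∧ Tendsto (fun J : ℕ => (J : ℝ) * ψ J) atTop (𝓝 0) ∧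
          ∀ (ν : ℕ → (j : ℕ) → Measure (GaugeField (F.P j) 0 (Matrix.specialUnitaryGroup (Fin 2) ℂ))),
            (∀ K, ν K K = T4GenFunBounds.gibbsMeasure (F.P K) ((F.scheme ℰp γ).β K)) →
            (∀ K j, j < K → ν K j = Measure.map (descend F ℰp j) (ν K (j + 1))) →
            ∀ (J K : ℕ) (hJK : J ≤ K) (ρ : GaugeField (F.P J) 0 (Matrix.specialUnitaryGroup (Fin 2) ℂ) → ℝ),
              (∀ U, PlaqSmall (θBal F.L γ b₀ p₀ J) U → 0 < ρ U) →
              ν K J = (fieldMeasure _ _ _).withDensity (fun U => ENNReal.ofReal (ρ U)) →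
              ContinuousOn ρ {U | PlaqSmall (θBal F.L γ b₀ p₀ J) U} →
              (∀ U : GaugeField (F.P J) 0 (Matrix.specialUnitaryGroup (Fin 2) ℂ), PlaqSmall (θBal F.L γ b₀ p₀ J) U →
                  0 < heightDensityCan F γ hJK (histGood F ℰp (θBal F.L γ b₀ p₀) K J) U) →
              ∀ (b b' : PBond (F.P J) 0) (U V W Z : GaugeField (F.P J) 0 (Matrix.specialUnitaryGroup (Fin 2) ℂ)),
                PlaqSmall (θBal F.L γ b₀ p₀ J) U → PlaqSmall (θBal F.L γ b₀ p₀ J) V →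
                PlaqSmall (θBal F.L γ b₀ p₀ J) W → PlaqSmall (θBal F.L γ b₀ p₀ J) Z →
                (∀ e, e ≠ b → U e = V e) → (∀ e, e ≠ b' → U e = W e) → (∀ e, e ≠ b' → V e = Z e) → (∀ e, e ≠ b → W e = Z e) →
                |(((Real.log (ρ U) - Real.log (heightDensityCan F γ hJK (histGood F ℰp (θBal F.L γ b₀ p₀) K J) U)) - (Real.log (ρ V) - Real.log (heightDensityCan F γ hJK (histGood F ℰp (θBal F.L γ b₀ p₀) K J) V)))
            - ((Real.log (ρ W) - Real.log (heightDensityCan F γ hJK (histGood F ℰp (θBal F.L γ b₀ p₀) K J) W)) - (Real.log (ρ Z) - Real.log (heightDensityCan F γ hJK (histGood F ℰp (θBal F.L γ b₀ p₀) K J) Z))))|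
                  ≤ ψ J * Real.exp (-(κ * (b.src.tdist b'.src : ℝ))) :=
  largeFieldFourPtCan_of_interiorRegSet_of_levelOddsLedger hint (levelOddsLedger_of_below h)

end Summit.QuantumFields.YangMills.Theorems.FluctuationComparisonRegPrIntLOddsLedgerReductionOfInteriorRegSet

end
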